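import Mathlib.Analysis.SpecificLimits.Normed
import Mathlib.Analysis.Calculus.LocalExtr.Basic
import Mathlib.Topology.Order.LiminfLimsup
import Literature.Analysis.FluidPDE.SawtoothCascadeDriftFree
import Literature.Analysis.FluidPDE.SawtoothCascadeSmooth
import HarnessLib
import Summits.AnomalousDissipation.AnomalousDissipation.Theses.SawtoothPulseCascade

/-!
# K3loc, line `DriftFree` — helper: the cascade force `∂ₜū` is bounded on `[0,1) × 𝕋²`

Helper file of the lead prover for the crux `K3LocalisedClosure` (stmt-AnomalousDissipation-19492) of the route
`SawtoothPulseCascade`, line `DriftFree` (skeleton v3, vocabulary `Literature/Analysis/FluidPDE/SawtoothCascadeDriftFree`).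
It proves the one quantitative input about the explicit force that the closure stub `stub_driftFreeClosure` needs
and that none of its hypotheses carries: a uniform sup bound of `planarForce P = ∂ₜū` on `[0,1) × 𝕋²`
(`exists_norm_planarForce_le`, for `δ₀ > 0`, `d > 0`, `N₀ ≥ 1`, `ρN ≥ 2`).  Without it the gradient energy of the
planar Navier–Stokes solution `V_ν` is not known to be integrable up to `t = 1` and
`Torus.cumulativeDissipation … 0 1` would be a junk value.

THE COMPUTATION.  `bump' = 0` off `(0,1)` and `|bump'| ≤ B` (§F1); `rateH j` / `rateV j` are `C¹` with
`|rate'| ≤ |γ| B / tHalf j²` and `rate' = 0` off the OPEN half-slot of phase `j`, the open half-slots being pairwise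
disjoint (§F2); `|U j| ≤ (π/2)/(2π N_j)` (§F3); the per-phase constants `|γ| B /(tHalf j)² · (π/2)/(2π N_j)
= |γ| B π⁸ (j+1)⁸ / (8100 N₀ ρN^j)` are bounded since `(j+1)⁸/ρN^j → 0` (§F4); and the components of `∂ₜū(t, x)`
within `[0,1)` are the finite sums `Σ_{j<J} rateH j'(t) U_j(x₂)`, `Σ_{j<J} rateV j'(t) U_j(x₁)` for `t < tStart J`
(uniqueness of one-sided derivatives within `[0,1)`, `SawtoothCascadeSmooth.tsum_rateH_eq_sum_of_lt`), in each of
which at most ONE term is non-zero (§F5).  All elementary; reused by `stub_regularity` (the `α = 0` sup bound).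
-/

-- `Summit.<Summit>.<Problem>`: single-conjunct summit, the duplicate namespace segment is deliberate.
set_option linter.dupNamespace false

noncomputable section

namespace Summit.AnomalousDissipation.AnomalousDissipation.Theorems.SawtoothPulseCascade.DriftFreeClosure

open scoped InnerProductSpace ENNReal NNReal
open MeasureTheory Set Filter Topology
open Literature.Analysis Literature.Analysis.FunctionSpaces Literature.Analysis.FluidPDE
open Literature.Analysis.FluidPDE.SawtoothCascade
open Literature.Analysis.FluidPDE.SawtoothCascade.DriftFree

/-! ## §F1 The bump: bounded derivative, vanishing outside `(0,1)` -/

/-- `bump' s = 0` for `s ∉ (0,1)` (there `bump` attains its minimum `0`). [folklore] -/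
theorem deriv_bump_eq_zero {s : ℝ} (hs : s ∉ Ioo (0 : ℝ) 1) : deriv CascadeParams.bump s = 0 := by
  have h0 : CascadeParams.bump s = 0 := by
    by_cases h : s ≤ 0
    · exact bump_of_nonpos h
    · have h1 : 1 ≤ s := by
        by_contra h'
        exact hs ⟨lt_of_not_ge h, lt_of_not_ge h'⟩
      exact bump_of_one_le h1
  have hmin : IsLocalMin CascadeParams.bump s :=
    Filter.Eventually.of_forall fun x => by rw [h0]; exact bump_nonneg x
  exact hmin.deriv_eq_zero

/-- `bump'` is bounded: `∃ B ≥ 0, |bump' s| ≤ B` for all `s`. [folklore] -/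
theorem exists_abs_deriv_bump_le : ∃ B : ℝ, 0 ≤ B ∧ ∀ s, |deriv CascadeParams.bump s| ≤ B := by
  have hc : Continuous (deriv CascadeParams.bump) :=
    contDiff_bump.continuous_deriv (by simp)
  obtain ⟨B, hB⟩ := isCompact_Icc.exists_bound_of_continuousOn (hc.continuousOn (s := Icc (0 : ℝ) 1))
  refine ⟨max B 0, le_max_right _ _, fun s => ?_⟩
  by_cases hs : s ∈ Ioo (0 : ℝ) 1
  · exact ((Real.norm_eq_abs _).symm.le.trans (hB s (Ioo_subset_Icc_self hs))).trans (le_max_left _ _)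
  · rw [deriv_bump_eq_zero hs, abs_zero]; exact le_max_right _ _

/-! ## §F2 Time derivatives of the pulse rates -/

namespace Rates

variable (P : CascadeParams)

/-- Chain rule for `rateH j t = γ/tHalf j · bump ((t − tStart j)/tHalf j)`. [folklore] -/
theorem hasDerivAt_rateH (j : ℕ) (t : ℝ) :
    HasDerivAt (P.rateH j)
      (P.γ / CascadeParams.tHalf j *
        (deriv CascadeParams.bump ((t - CascadeParams.tStart j) / CascadeParams.tHalf j) *
          (1 / CascadeParams.tHalf j))) t := by
  have h1 : HasDerivAt (fun s : ℝ => (s - CascadeParams.tStart j) / CascadeParams.tHalf j)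
      (1 / CascadeParams.tHalf j) t := by
    simpa using ((hasDerivAt_id t).sub_const (CascadeParams.tStart j)).div_const (CascadeParams.tHalf j)
  have h2 : HasDerivAt CascadeParams.bump
      (deriv CascadeParams.bump ((t - CascadeParams.tStart j) / CascadeParams.tHalf j))
      ((t - CascadeParams.tStart j) / CascadeParams.tHalf j) :=
    ((contDiff_bump.differentiable (by simp)) _).hasDerivAt
  have h3 := (h2.comp t h1).const_mul (P.γ / CascadeParams.tHalf j)
  exact h3

/-- Chain rule for `rateV j t = γ/tHalf j · bump ((t − tStart j − tHalf j)/tHalf j)`. [folklore] -/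
theorem hasDerivAt_rateV (j : ℕ) (t : ℝ) :
    HasDerivAt (P.rateV j)
      (P.γ / CascadeParams.tHalf j *
        (deriv CascadeParams.bump ((t - CascadeParams.tStart j - CascadeParams.tHalf j) / CascadeParams.tHalf j) *
          (1 / CascadeParams.tHalf j))) t := by
  have h1 : HasDerivAt (fun s : ℝ => (s - CascadeParams.tStart j - CascadeParams.tHalf j) / CascadeParams.tHalf j)
      (1 / CascadeParams.tHalf j) t := by
    simpa using (((hasDerivAt_id t).sub_const (CascadeParams.tStart j)).sub_const
      (CascadeParams.tHalf j)).div_const (CascadeParams.tHalf j)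
  have h2 : HasDerivAt CascadeParams.bump
      (deriv CascadeParams.bump ((t - CascadeParams.tStart j - CascadeParams.tHalf j) / CascadeParams.tHalf j))
      ((t - CascadeParams.tStart j - CascadeParams.tHalf j) / CascadeParams.tHalf j) :=
    ((contDiff_bump.differentiable (by simp)) _).hasDerivAt
  exact (h2.comp t h1).const_mul (P.γ / CascadeParams.tHalf j)

/-- `|rateH j'(t)| ≤ |γ| B / tHalf j²` for a bound `B` of `|bump'|`. [folklore] -/
theorem abs_deriv_rateH_le {B : ℝ} (hB : ∀ s, |deriv CascadeParams.bump s| ≤ B) (j : ℕ) (t : ℝ) :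
    |deriv (P.rateH j) t| ≤ |P.γ| * B / CascadeParams.tHalf j ^ 2 := by
  rw [(hasDerivAt_rateH P j t).deriv]
  have hh := CascadeParams.tHalf_pos j
  rw [abs_mul, abs_mul, abs_div, abs_of_pos hh, abs_of_pos (by positivity : (0:ℝ) < 1 / CascadeParams.tHalf j)]
  have := hB ((t - CascadeParams.tStart j) / CascadeParams.tHalf j)
  have hγ := abs_nonneg P.γ
  calc |P.γ| / CascadeParams.tHalf j * (|deriv CascadeParams.bump ((t - CascadeParams.tStart j) / CascadeParams.tHalf j)| * (1 / CascadeParams.tHalf j))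
      ≤ |P.γ| / CascadeParams.tHalf j * (B * (1 / CascadeParams.tHalf j)) := by gcongr
    _ = |P.γ| * B / CascadeParams.tHalf j ^ 2 := by field_simp

/-- `|rateV j'(t)| ≤ |γ| B / tHalf j²`. [folklore] -/
theorem abs_deriv_rateV_le {B : ℝ} (hB : ∀ s, |deriv CascadeParams.bump s| ≤ B) (j : ℕ) (t : ℝ) :
    |deriv (P.rateV j) t| ≤ |P.γ| * B / CascadeParams.tHalf j ^ 2 := by
  rw [(hasDerivAt_rateV P j t).deriv]
  have hh := CascadeParams.tHalf_pos j
  rw [abs_mul, abs_mul, abs_div, abs_of_pos hh, abs_of_pos (by positivity : (0:ℝ) < 1 / CascadeParams.tHalf j)]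
  have := hB ((t - CascadeParams.tStart j - CascadeParams.tHalf j) / CascadeParams.tHalf j)
  have hγ := abs_nonneg P.γ
  calc |P.γ| / CascadeParams.tHalf j * (|deriv CascadeParams.bump ((t - CascadeParams.tStart j - CascadeParams.tHalf j) / CascadeParams.tHalf j)| * (1 / CascadeParams.tHalf j))
      ≤ |P.γ| / CascadeParams.tHalf j * (B * (1 / CascadeParams.tHalf j)) := by gcongr
    _ = |P.γ| * B / CascadeParams.tHalf j ^ 2 := by field_simp

/-- `rateH j' (t) = 0` off the open H half-slot of phase `j`. [folklore] -/
theorem deriv_rateH_eq_zero {j : ℕ} {t : ℝ}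
    (ht : t ∉ Ioo (CascadeParams.tStart j) (CascadeParams.tStart j + CascadeParams.tHalf j)) :
    deriv (P.rateH j) t = 0 := by
  rw [(hasDerivAt_rateH P j t).deriv]
  have hh := CascadeParams.tHalf_pos j
  have : (t - CascadeParams.tStart j) / CascadeParams.tHalf j ∉ Ioo (0 : ℝ) 1 := by
    intro h
    apply ht
    rw [mem_Ioo, lt_div_iff₀ hh, div_lt_iff₀ hh] at h
    constructor <;> linarith [h.1, h.2]
  rw [deriv_bump_eq_zero this]; simp

/-- `rateV j' (t) = 0` off the open V half-slot of phase `j`. [folklore] -/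
theorem deriv_rateV_eq_zero {j : ℕ} {t : ℝ}
    (ht : t ∉ Ioo (CascadeParams.tStart j + CascadeParams.tHalf j) (CascadeParams.tStart (j + 1))) :
    deriv (P.rateV j) t = 0 := by
  rw [(hasDerivAt_rateV P j t).deriv]
  have hh := CascadeParams.tHalf_pos j
  have : (t - CascadeParams.tStart j - CascadeParams.tHalf j) / CascadeParams.tHalf j ∉ Ioo (0 : ℝ) 1 := by
    intro h
    apply ht
    rw [mem_Ioo, lt_div_iff₀ hh, div_lt_iff₀ hh] at h
    rw [CascadeParams.tStart_succ]
    constructor <;> linarith [h.1, h.2]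
  rw [deriv_bump_eq_zero this]; simp

/-- The open H half-slots are pairwise disjoint: if `rateH j'(t) ≠ 0` and `rateH j''(t) ≠ 0` then `j = j'`.
[folklore] -/
theorem eq_of_deriv_rateH_ne_zero {j j' : ℕ} {t : ℝ} (hj : deriv (P.rateH j) t ≠ 0)
    (hj' : deriv (P.rateH j') t ≠ 0) : j = j' := by
  by_contra hne
  have mj : t ∈ Ioo (CascadeParams.tStart j) (CascadeParams.tStart j + CascadeParams.tHalf j) := by
    by_contra h; exact hj (deriv_rateH_eq_zero P h)
  have mj' : t ∈ Ioo (CascadeParams.tStart j') (CascadeParams.tStart j' + CascadeParams.tHalf j') := by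
    by_contra h; exact hj' (deriv_rateH_eq_zero P h)
  have key : ∀ a b : ℕ, a < b → CascadeParams.tStart a + CascadeParams.tHalf a ≤ CascadeParams.tStart b := by
    intro a b hab
    have h1 : CascadeParams.tStart (a + 1) ≤ CascadeParams.tStart b := CascadeParams.tStart_strictMono.monotone hab
    rw [CascadeParams.tStart_succ] at h1
    linarith [CascadeParams.tHalf_pos a]
  rcases lt_or_gt_of_ne hne with h | h
  · linarith [key j j' h, mj.2, mj'.1]
  · linarith [key j' j h, mj'.2, mj.1]

/-- The open V half-slots are pairwise disjoint. [folklore] -/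
theorem eq_of_deriv_rateV_ne_zero {j j' : ℕ} {t : ℝ} (hj : deriv (P.rateV j) t ≠ 0)
    (hj' : deriv (P.rateV j') t ≠ 0) : j = j' := by
  by_contra hne
  have mj : t ∈ Ioo (CascadeParams.tStart j + CascadeParams.tHalf j) (CascadeParams.tStart (j + 1)) := by
    by_contra h; exact hj (deriv_rateV_eq_zero P h)
  have mj' : t ∈ Ioo (CascadeParams.tStart j' + CascadeParams.tHalf j') (CascadeParams.tStart (j' + 1)) := by
    by_contra h; exact hj' (deriv_rateV_eq_zero P h)
  have key : ∀ a b : ℕ, a < b → CascadeParams.tStart (a + 1) ≤ CascadeParams.tStart b + CascadeParams.tHalf b := by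
    intro a b hab
    have h1 : CascadeParams.tStart (a + 1) ≤ CascadeParams.tStart b := CascadeParams.tStart_strictMono.monotone hab
    linarith [CascadeParams.tHalf_pos b]
  rcases lt_or_gt_of_ne hne with h | h
  · linarith [key j j' h, mj.2, mj'.1]
  · linarith [key j' j h, mj'.2, mj.1]

/-! ## §F3 The profiles are small: `|U j| ≤ (π/2)/(2π N_j)` -/

/-- `|S_δ(θ)| ≤ π/2` (`δ > 0`): an average of `tri`, `|tri| ≤ π/2`. [folklore] -/
theorem abs_roundedSaw_le {δ : ℝ} (hδ : 0 < δ) (θ : ℝ) : |roundedSaw δ θ| ≤ Real.pi / 2 := by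
  unfold roundedSaw
  rw [← Real.norm_eq_abs]
  calc ‖∫ y, tri (θ - y) * gaussKernel δ y‖ ≤ ∫ y, Real.pi / 2 * gaussKernel δ y := by
        refine norm_integral_le_of_norm_le ((integrable_gaussKernel hδ).const_mul _)
          (ae_of_all _ fun y => ?_)
        rw [Real.norm_eq_abs, abs_mul, abs_of_nonneg (gaussKernel_nonneg hδ.le y)]
        exact mul_le_mul_of_nonneg_right (abs_tri_le _) (gaussKernel_nonneg hδ.le y)
    _ = Real.pi / 2 := by rw [integral_const_mul, integral_gaussKernel hδ, mul_one]

/-- `|U j (y)| ≤ (π/2) / (2π N_j)` (`δ_j > 0`, `N_j ≥ 1`). [folklore] -/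
theorem abs_U_le {j : ℕ} (hδ : 0 < P.δ j) (hN : 0 < P.N j) (y : ℝ) :
    |P.U j y| ≤ (Real.pi / 2) / (2 * Real.pi * P.N j) := by
  unfold CascadeParams.U
  have hd : 0 < 2 * Real.pi * (P.N j : ℝ) := by positivity
  rw [abs_div, abs_of_pos hd]
  exact div_le_div_of_nonneg_right (abs_roundedSaw_le hδ _) hd.le

/-! ## §F4 The per-phase constants are bounded (`ρN ≥ 2`) -/

/-- For `ρ ≥ 2` the sequence `(j+1)⁸ / ρ^j` is bounded. [folklore] -/
theorem exists_pow_eight_div_pow_le {ρ : ℝ} (hρ : 2 ≤ ρ) : ∃ M : ℝ, ∀ j : ℕ, ((j : ℝ) + 1) ^ 8 / ρ ^ j ≤ M := by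
  have hρ1 : 1 < ρ := by linarith
  have h0 : Tendsto (fun n : ℕ => (n : ℝ) ^ 8 / ρ ^ n) atTop (𝓝 0) :=
    tendsto_pow_const_div_const_pow_of_one_lt 8 hρ1
  have h1 : Tendsto (fun j : ℕ => ρ * (((j + 1 : ℕ) : ℝ) ^ 8 / ρ ^ (j + 1))) atTop (𝓝 (ρ * 0)) :=
    (h0.comp (tendsto_add_atTop_nat 1)).const_mul ρ
  have hb := h1.bddAbove_range
  obtain ⟨M, hM⟩ := hb
  refine ⟨M, fun j => ?_⟩
  have hj : ρ * ((((j + 1 : ℕ) : ℝ)) ^ 8 / ρ ^ (j + 1)) ≤ M := hM ⟨j, rfl⟩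
  have hρ0 : 0 < ρ := by positivity
  have e : ρ * ((((j + 1 : ℕ) : ℝ)) ^ 8 / ρ ^ (j + 1)) = ((j : ℝ) + 1) ^ 8 / ρ ^ j := by
    rw [mul_div_assoc', div_eq_div_iff (by positivity) (by positivity)]
    push_cast
    ring
  rw [e] at hj
  exact hj

/-- Uniform bound of the per-phase force constants: `∃ K, |γ| B /(tHalf j)² · (π/2)/(2π N_j) ≤ K` for all `j`
(`N₀ ≥ 1`, `ρN ≥ 2`). [folklore] -/
theorem exists_phase_const_le (hN₀ : 1 ≤ P.N₀) (hρ : 2 ≤ P.ρN) (B : ℝ) (hB : 0 ≤ B) :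
    ∃ K : ℝ, 0 ≤ K ∧ ∀ j : ℕ,
      |P.γ| * B / CascadeParams.tHalf j ^ 2 * ((Real.pi / 2) / (2 * Real.pi * P.N j)) ≤ K := by
  obtain ⟨M, hM⟩ := exists_pow_eight_div_pow_le (ρ := (P.ρN : ℝ)) (by exact_mod_cast hρ)
  have hM0 : 0 ≤ M := le_trans (by positivity) (hM 0)
  -- the constant: |γ| B π⁸ M / (4 · 2025 · N₀)
  refine ⟨|P.γ| * B * Real.pi ^ 8 * M / (4 * 2025 * P.N₀), by positivity, fun j => ?_⟩
  have hN : (P.N j : ℝ) = P.N₀ * (P.ρN : ℝ) ^ j := by simp [CascadeParams.N]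
  have hth : CascadeParams.tHalf j = 45 / (Real.pi ^ 4 * ((j : ℝ) + 1) ^ 4) := rfl
  have hπ : 0 < Real.pi := Real.pi_pos
  have hN₀' : (1 : ℝ) ≤ P.N₀ := by exact_mod_cast hN₀
  have hρ' : (2 : ℝ) ≤ P.ρN := by exact_mod_cast hρ
  have hj1 : (0 : ℝ) < (j : ℝ) + 1 := by positivity
  rw [hth, hN]
  have e : |P.γ| * B / (45 / (Real.pi ^ 4 * ((j : ℝ) + 1) ^ 4)) ^ 2 * (Real.pi / 2 / (2 * Real.pi * (↑P.N₀ * (P.ρN : ℝ) ^ j)))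
      = |P.γ| * B * Real.pi ^ 8 / (4 * 2025 * P.N₀) * (((j : ℝ) + 1) ^ 8 / (P.ρN : ℝ) ^ j) := by
    field_simp
    ring
  rw [e]
  calc |P.γ| * B * Real.pi ^ 8 / (4 * 2025 * P.N₀) * (((j : ℝ) + 1) ^ 8 / (P.ρN : ℝ) ^ j)
      ≤ |P.γ| * B * Real.pi ^ 8 / (4 * 2025 * P.N₀) * M := mul_le_mul_of_nonneg_left (hM j) (by positivity)
    _ = |P.γ| * B * Real.pi ^ 8 * M / (4 * 2025 * P.N₀) := by ring

end Rates


/-! ## §F5 The time derivative of the cascade field, componentwise, and its sup bound -/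

namespace Rates

variable (P : CascadeParams)

/-- A finite sum of nonnegative reals of which at most one is nonzero is bounded by the termwise bound. [folklore] -/
theorem sum_le_of_atMostOne {s : Finset ℕ} {f : ℕ → ℝ} {K : ℝ} (hK0 : 0 ≤ K) (hf : ∀ j, f j ≤ K)
    (huniq : ∀ j j', f j ≠ 0 → f j' ≠ 0 → j = j') : ∑ j ∈ s, f j ≤ K := by
  by_cases h : ∃ j ∈ s, f j ≠ 0
  · obtain ⟨j₀, hj₀, hne⟩ := h
    rw [Finset.sum_eq_single_of_mem j₀ hj₀ fun j _ hj => ?_]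
    · exact hf j₀
    · by_contra hfj
      exact hj (huniq j j₀ hfj hne)
  · push Not at h
    rw [Finset.sum_eq_zero h]
    exact hK0

/-- Component `0` of the cascade field is the H sum. [folklore] -/
theorem field_apply_zero (t : ℝ) (x : UnitAddTorus (Fin 2)) :
    P.field t x 0 = ∑' j, P.rateH j t * P.U j (Torus.repr x 1) := by
  simp [CascadeParams.field]

/-- Component `1` of the cascade field is the V sum. [folklore] -/
theorem field_apply_one (t : ℝ) (x : UnitAddTorus (Fin 2)) :
    P.field t x 1 = ∑' j, P.rateV j t * P.U j (Torus.repr x 0) := by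
  simp [CascadeParams.field]

/-- Time derivative of component `0` within `[0,1)`: below `tStart J` only the phases `j < J` contribute. [folklore] -/
theorem hasDerivWithinAt_field_apply_zero {t : ℝ} {J : ℕ} (hJ : t < CascadeParams.tStart J)
    (x : UnitAddTorus (Fin 2)) :
    HasDerivWithinAt (fun s => P.field s x 0)
      (∑ j ∈ Finset.range J, deriv (P.rateH j) t * P.U j (Torus.repr x 1)) (Ico (0 : ℝ) 1) t := by
  have hg : HasDerivAt (fun s => ∑ j ∈ Finset.range J, P.rateH j s * P.U j (Torus.repr x 1))
      (∑ j ∈ Finset.range J, deriv (P.rateH j) t * P.U j (Torus.repr x 1)) t :=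
    HasDerivAt.fun_sum fun j _ => ((hasDerivAt_rateH P j t).differentiableAt.hasDerivAt).mul_const _
  refine hg.hasDerivWithinAt.congr_of_eventuallyEq ?_ ?_
  · have hmem : Iio (CascadeParams.tStart J) ∈ 𝓝[Ico (0 : ℝ) 1] t :=
      mem_nhdsWithin_of_mem_nhds (Iio_mem_nhds hJ)
    filter_upwards [hmem] with s hs
    rw [field_apply_zero, P.tsum_rateH_eq_sum_of_lt hs]
  · rw [field_apply_zero, P.tsum_rateH_eq_sum_of_lt hJ]

/-- Time derivative of component `1` within `[0,1)`. [folklore] -/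
theorem hasDerivWithinAt_field_apply_one {t : ℝ} {J : ℕ} (hJ : t < CascadeParams.tStart J)
    (x : UnitAddTorus (Fin 2)) :
    HasDerivWithinAt (fun s => P.field s x 1)
      (∑ j ∈ Finset.range J, deriv (P.rateV j) t * P.U j (Torus.repr x 0)) (Ico (0 : ℝ) 1) t := by
  have hg : HasDerivAt (fun s => ∑ j ∈ Finset.range J, P.rateV j s * P.U j (Torus.repr x 0))
      (∑ j ∈ Finset.range J, deriv (P.rateV j) t * P.U j (Torus.repr x 0)) t :=
    HasDerivAt.fun_sum fun j _ => ((hasDerivAt_rateV P j t).differentiableAt.hasDerivAt).mul_const _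
  refine hg.hasDerivWithinAt.congr_of_eventuallyEq ?_ ?_
  · have hmem : Iio (CascadeParams.tStart J) ∈ 𝓝[Ico (0 : ℝ) 1] t :=
      mem_nhdsWithin_of_mem_nhds (Iio_mem_nhds hJ)
    filter_upwards [hmem] with s hs
    rw [field_apply_one, P.tsum_rateV_eq_sum_of_lt hs]
  · rw [field_apply_one, P.tsum_rateV_eq_sum_of_lt hJ]

/-- The components of `∂ₜū` within `[0,1)` (the field being jointly smooth there). [folklore] -/
theorem timeDerivWithin_field_apply (hfs : CascadeFieldSmooth P) {t : ℝ} (ht : t ∈ Ico (0 : ℝ) 1) {J : ℕ}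
    (hJ : t < CascadeParams.tStart J) (x : UnitAddTorus (Fin 2)) :
    FunctionSpaces.Torus.timeDerivWithin (Ico (0 : ℝ) 1) P.field t x 0 =
        ∑ j ∈ Finset.range J, deriv (P.rateH j) t * P.U j (Torus.repr x 1) ∧
      FunctionSpaces.Torus.timeDerivWithin (Ico (0 : ℝ) 1) P.field t x 1 =
        ∑ j ∈ Finset.range J, deriv (P.rateV j) t * P.U j (Torus.repr x 0) := by
  have h1 : HasDerivWithinAt (fun s => P.field s x) (FunctionSpaces.Torus.timeDerivWithin (Ico (0 : ℝ) 1) P.field t x)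
      (Ico (0 : ℝ) 1) t := hfs.hasDerivWithinAt_slice ht x
  have hU : UniqueDiffWithinAt ℝ (Ico (0 : ℝ) 1) t := uniqueDiffOn_Ico 0 1 t ht
  have h0 : HasDerivWithinAt (fun s => P.field s x 0)
      (FunctionSpaces.Torus.timeDerivWithin (Ico (0 : ℝ) 1) P.field t x 0) (Ico (0 : ℝ) 1) t :=
    (PiLp.proj 2 (fun _ : Fin 2 => ℝ) (0 : Fin 2)).hasFDerivAt.comp_hasDerivWithinAt t h1
  have h1' : HasDerivWithinAt (fun s => P.field s x 1)
      (FunctionSpaces.Torus.timeDerivWithin (Ico (0 : ℝ) 1) P.field t x 1) (Ico (0 : ℝ) 1) t :=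
    (PiLp.proj 2 (fun _ : Fin 2 => ℝ) (1 : Fin 2)).hasFDerivAt.comp_hasDerivWithinAt t h1
  exact ⟨hU.eq_deriv _ h0 (hasDerivWithinAt_field_apply_zero P hJ x),
    hU.eq_deriv _ h1' (hasDerivWithinAt_field_apply_one P hJ x)⟩

/-- **The cascade force is bounded**: for `0 < δ₀`, `0 < d`, `N₀ ≥ 1`, `ρN ≥ 2` there is `C` with
`‖∂ₜū(t, x)‖ ≤ C` on `[0,1) × 𝕋²` (on each open half-slot exactly one pulse rate moves, `|rate'| ≤ |γ|B/tHalf_j²`,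
`|U_j| ≤ 1/(4N_j)`, and `(j+1)⁸/ρN^j` is bounded). [folklore] -/
theorem exists_norm_timeDerivWithin_field_le (hδ₀ : 0 < P.δ₀) (hd : 0 < P.d) (hN₀ : 1 ≤ P.N₀) (hρ : 2 ≤ P.ρN) :
    ∃ C : ℝ, ∀ t ∈ Ico (0 : ℝ) 1, ∀ x : UnitAddTorus (Fin 2),
      ‖FunctionSpaces.Torus.timeDerivWithin (Ico (0 : ℝ) 1) P.field t x‖ ≤ C := by
  have hfs : CascadeFieldSmooth P := cascadeFieldSmooth P hδ₀ hd
  obtain ⟨B, hB0, hB⟩ := exists_abs_deriv_bump_le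
  obtain ⟨K, hK0, hK⟩ := exists_phase_const_le P hN₀ hρ B hB0
  have hNpos : ∀ j, 0 < P.N j := fun j => P.N_pos hN₀ (le_trans (by norm_num) hρ) j
  have hδpos : ∀ j, 0 < P.δ j := fun j => P.δ_pos hδ₀ hd j
  refine ⟨K + K, fun t ht x => ?_⟩
  obtain ⟨J, hJ⟩ : ∃ J, t < CascadeParams.tStart J :=
    ((tendsto_order.1 CascadeParams.tendsto_tStart).1 t ht.2).exists
  obtain ⟨e0, e1⟩ := timeDerivWithin_field_apply P hfs ht hJ x
  set v := FunctionSpaces.Torus.timeDerivWithin (Ico (0 : ℝ) 1) P.field t x with hv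
  -- each component is bounded by `K`
  have hterm : ∀ (rate : ℕ → ℝ → ℝ) (y : ℝ), (∀ j t, |deriv (rate j) t| ≤ |P.γ| * B / CascadeParams.tHalf j ^ 2) →
      (∀ j j', deriv (rate j) t ≠ 0 → deriv (rate j') t ≠ 0 → j = j') →
      |∑ j ∈ Finset.range J, deriv (rate j) t * P.U j y| ≤ K := by
    intro rate y hrate huniq
    refine (Finset.abs_sum_le_sum_abs _ _).trans ?_
    refine sum_le_of_atMostOne hK0 (fun j => ?_) (fun j j' hj hj' => huniq j j' ?_ ?_)
    · rw [abs_mul]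
      calc |deriv (rate j) t| * |P.U j y|
          ≤ |P.γ| * B / CascadeParams.tHalf j ^ 2 * ((Real.pi / 2) / (2 * Real.pi * P.N j)) :=
            mul_le_mul (hrate j t) (abs_U_le P (hδpos j) (hNpos j) y) (abs_nonneg _) (by positivity)
        _ ≤ K := hK j
    · intro h; exact hj (by rw [h, zero_mul, abs_zero])
    · intro h; exact hj' (by rw [h, zero_mul, abs_zero])
  have hc0 : |v 0| ≤ K := by
    rw [e0]
    exact hterm P.rateH _ (fun j t => abs_deriv_rateH_le P hB j t) (fun j j' h h' => eq_of_deriv_rateH_ne_zero P h h')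
  have hc1 : |v 1| ≤ K := by
    rw [e1]
    exact hterm P.rateV _ (fun j t => abs_deriv_rateV_le P hB j t) (fun j j' h h' => eq_of_deriv_rateV_ne_zero P h h')
  -- `‖v‖ ≤ |v 0| + |v 1|`
  have hn : ‖v‖ ≤ |v 0| + |v 1| := by
    rw [EuclideanSpace.norm_eq, Fin.sum_univ_two, Real.norm_eq_abs, Real.norm_eq_abs, Real.sqrt_le_left]
    · nlinarith [abs_nonneg (v 0), abs_nonneg (v 1), sq_abs (v 0), sq_abs (v 1)]
    · positivity
  linarith

end Rates

/-- **The planar force of the cascade is bounded on `[0,1) × 𝕋²`** (box parameters `δ₀ > 0`, `d > 0`, `N₀ ≥ 1`,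
`ρN ≥ 2`). [folklore] -/
theorem exists_norm_planarForce_le (P : CascadeParams) (hδ₀ : 0 < P.δ₀) (hd : 0 < P.d) (hN₀ : 1 ≤ P.N₀)
    (hρ : 2 ≤ P.ρN) :
    ∃ C : ℝ, ∀ t ∈ Ico (0 : ℝ) 1, ∀ y : UnitAddTorus (Fin 2), ‖planarForce P t y‖ ≤ C := by
  obtain ⟨C, hC⟩ := Rates.exists_norm_timeDerivWithin_field_le P hδ₀ hd hN₀ hρ
  refine ⟨C, fun t ht y => ?_⟩
  simp only [planarForce, if_pos ht.2]
  exact hC t ht y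

end Summit.AnomalousDissipation.AnomalousDissipation.Theorems.SawtoothPulseCascade.DriftFreeClosure

end
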